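import Mathlib
import HarnessLib
import Literature.MathematicalPhysics.StatisticalMechanics.LinearisedMapABKMContraction

/-!
# The contraction constant of the linearised map decays: `L^d · abkmContrConst d L R ≤ K · L^{−1/2}`
# and `L^d · abkmContrConst d L R → 0` as `L → ∞` ([ABKM19] Lemma 10.1 / Theorem 6.7: `θ < 1` for `L` large)

`LinearisedMapABKMContraction.weakNormLE_opC_abkm` bounds the linearised map by
`‖C K‖_{k+1} ≤ (L^d · A_𝒫 · abkmContrConst d L R + …)‖K‖_k`; for the contraction `θ < 1` of [ABKM19]
Theorem 6.7 / Lemma 10.1 one needs `L^d · abkmContrConst d L R → 0` as `L → ∞` (the integration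
constant `A_𝒫` being `L`-independent).  Written out, with `κ_L = 2L^{−(d−2)/2}` (`scaleRatio`),
`E = d(2R+2)+1`, `n₁ = ⌊d/2⌋+2`,
`abkmContrConst = 1536(1 + C_{8.7})(κ_L E^{n₁} L^{−n₁} + κ_L E² L^{−2}(2κ_L/L + κ_L E² L^{−2}) + 3(κ_L/L)³)`,
and every term times `L^d` is `c · L^{e}` with `e ≤ −1/2` (`d ≥ 3`): `L^d κ_L L^{−n₁} = 2E^{n₁}L^{d/2+1−n₁}`,
`L^d κ_L² L^{−3} = 4L^{−1}`, `L^d κ_L² L^{−4} = 4L^{−2}`, `L^d κ_L³ L^{−3} = 8L^{−d/2}`.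

* `scaleRatio_eq_rpow` — `κ_L = 2 · L^{−(d−2)/2}` as a real power;
* **`pow_mul_abkmContrConst_le`** — `L^d · abkmContrConst d L R ≤ abkmDecayConst d R · L^{−1/2}`
  for `L ≥ 1`, `d ≥ 3`, with the explicit constant `abkmDecayConst`;
* **`tendsto_pow_mul_abkmContrConst`** — `L^d · abkmContrConst d L R → 0` (`L → ∞` in `ℕ`).

Everything is proved; no named fact.

## References
* S. Adams, S. Buchholz, R. Kotecký, S. Müller, arXiv:1910.13564, Theorem 6.7, Lemma 10.1 ((10.1)–(10.4)),
  Lemma 10.3 (10.10) [AdamsBuchholzKoteckyMuller2019].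
-/

noncomputable section

namespace Literature.MathematicalPhysics.StatisticalMechanics.GradientRG

open Filter Topology

variable {d : ℕ}

/-- `κ_L = 2 · L^{−(d−2)/2}` as a real power (`L > 0`, `d ≥ 2`).
[cite: AdamsBuchholzKoteckyMuller2019, Lemma 8.1 (proof)] -/
theorem scaleRatio_eq_rpow (hd : 2 ≤ d) {L : ℕ} (hL : 0 < L) :
    scaleRatio d L = 2 * (L : ℝ) ^ (-(((d : ℝ) - 2) / 2)) := by
  have hx : (0 : ℝ) < L := by exact_mod_cast hL
  unfold scaleRatio
  rw [Real.sqrt_eq_rpow, ← Real.rpow_natCast, ← Real.rpow_mul hx.le, Nat.cast_sub hd, Nat.cast_two,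
    Real.rpow_neg hx.le, div_eq_mul_inv]
  ring_nf

/-- The explicit constant of the decay bound: `1536(1 + C_{8.7}(C₀))(2E^{n₁} + 8E² + 4E⁴ + 24)`,
`E = d(2R+2)+1`, `n₁ = ⌊d/2⌋+2`, `C₀ = (2R+2) + (⌊d/2⌋+1)`. [cite: AdamsBuchholzKoteckyMuller2019, Lemma 10.1] -/
def abkmDecayConst (d R : ℕ) : ℝ :=
  1536 * (1 + pi2BoundConst d (((2 * R + 2 : ℕ) : ℝ) + ((d / 2 + 1 : ℕ) : ℝ))) *
    (2 * ((d : ℝ) * ((2 * R + 2 : ℕ) : ℝ) + 1) ^ (d / 2 + 2) +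
      8 * ((d : ℝ) * ((2 * R + 2 : ℕ) : ℝ) + 1) ^ 2 + 4 * ((d : ℝ) * ((2 * R + 2 : ℕ) : ℝ) + 1) ^ 4 + 24)

/-- `abkmDecayConst ≥ 0`. [cite: AdamsBuchholzKoteckyMuller2019, Lemma 10.1] -/
theorem abkmDecayConst_nonneg (d R : ℕ) : 0 ≤ abkmDecayConst d R := by
  unfold abkmDecayConst
  have h1 : 0 ≤ pi2BoundConst d (((2 * R + 2 : ℕ) : ℝ) + ((d / 2 + 1 : ℕ) : ℝ)) :=
    pi2BoundConst_nonneg d (by positivity)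
  positivity

/-- **`L^d · abkmContrConst d L R ≤ abkmDecayConst d R · L^{−1/2}`** for `L ≥ 1`, `d ≥ 3`: every term of the
contraction constant times `L^d` is `c · L^{e}` with `e ≤ −1/2`.
[cite: AdamsBuchholzKoteckyMuller2019, Lemma 10.1] -/
theorem pow_mul_abkmContrConst_le (hd : 3 ≤ d) {L : ℕ} (hL : 1 ≤ L) (R : ℕ) :
    (L : ℝ) ^ d * abkmContrConst d L R ≤ abkmDecayConst d R * (L : ℝ) ^ (-(1 / 2 : ℝ)) := by
  have hL0 : 0 < L := hL
  have hx : (0 : ℝ) < L := by exact_mod_cast hL0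
  have hx1 : (1 : ℝ) ≤ L := by exact_mod_cast hL
  set x : ℝ := (L : ℝ) with hxdef
  set κ := scaleRatio d L with hκdef
  have hκ : κ = 2 * x ^ (-(((d : ℝ) - 2) / 2)) := scaleRatio_eq_rpow (by omega) hL0
  set E : ℝ := (d : ℝ) * ((2 * R + 2 : ℕ) : ℝ) + 1 with hE
  have hE1 : 1 ≤ E := by
    have : (0 : ℝ) ≤ (d : ℝ) * ((2 * R + 2 : ℕ) : ℝ) := by positivity
    linarith
  set P : ℝ := 1 + pi2BoundConst d (((2 * R + 2 : ℕ) : ℝ) + ((d / 2 + 1 : ℕ) : ℝ)) with hP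
  have hP0 : 0 ≤ P := by
    have := pi2BoundConst_nonneg d (show (0 : ℝ) ≤ ((2 * R + 2 : ℕ) : ℝ) + ((d / 2 + 1 : ℕ) : ℝ) by positivity)
    rw [hP]; linarith
  -- the powers of `x` that occur, as real powers
  set n₁ : ℕ := d / 2 + 2 with hn₁
  set y : ℝ := x ^ (-(1 / 2 : ℝ)) with hy
  have hy0 : 0 < y := Real.rpow_pos_of_pos hx _
  have hxr : ∀ r : ℝ, 0 < x ^ r := fun r => Real.rpow_pos_of_pos hx r
  -- comparison of exponents: `x^e ≤ x^{-1/2}` for `e ≤ -1/2`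
  have hexp : ∀ e : ℝ, e ≤ -(1 / 2 : ℝ) → x ^ e ≤ y := fun e he => Real.rpow_le_rpow_of_exponent_le hx1 he
  -- the four monomials
  have hd2 : (2 : ℝ) ≤ d := by exact_mod_cast (show 2 ≤ d by omega)
  have hd3 : (3 : ℝ) ≤ d := by exact_mod_cast hd
  have hn₁r : ((d : ℝ) - 1) / 2 + 2 ≤ (n₁ : ℝ) := by
    rw [hn₁]; push_cast
    have h := Nat.div_add_mod d 2
    have hmod : d % 2 < 2 := Nat.mod_lt d (by norm_num)
    have : (2 : ℝ) * ((d / 2 : ℕ) : ℝ) ≥ (d : ℝ) - 1 := by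
      have h' : ((2 * (d / 2) + d % 2 : ℕ) : ℝ) = (d : ℝ) := by exact_mod_cast h
      push_cast at h'
      have hm : ((d % 2 : ℕ) : ℝ) ≤ 1 := by exact_mod_cast (by omega : d % 2 ≤ 1)
      linarith
    linarith
  have hxpow : ∀ n : ℕ, x ^ n = x ^ (n : ℝ) := fun n => (Real.rpow_natCast x n).symm
  -- `A₁ = x^d κ / x^{n₁} = 2 x^{d - (d-2)/2 - n₁} ≤ 2y`
  have hA₁ : x ^ d * κ / x ^ n₁ ≤ 2 * y := by
    have heq : x ^ d * κ / x ^ n₁ = 2 * x ^ ((d : ℝ) + (-(((d : ℝ) - 2) / 2)) - (n₁ : ℝ)) := by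
      rw [hκ, hxpow d, hxpow n₁, Real.rpow_sub hx, Real.rpow_add hx]; ring
    rw [heq]
    refine mul_le_mul_of_nonneg_left (hexp _ ?_) (by norm_num)
    linarith
  -- `A₂ = x^d κ² / x³ = 4 x^{-1} ≤ 4y`
  have hA₂ : x ^ d * κ ^ 2 / x ^ 3 ≤ 4 * y := by
    have heq : x ^ d * κ ^ 2 / x ^ 3 = 4 * x ^ ((d : ℝ) + 2 * (-(((d : ℝ) - 2) / 2)) - (3 : ℕ)) := by
      rw [hκ, hxpow d, hxpow 3, Real.rpow_sub hx, Real.rpow_add hx, mul_pow, ← Real.rpow_natCast (x ^ _) 2,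
        ← Real.rpow_mul hx.le]
      push_cast; ring
    rw [heq]
    refine mul_le_mul_of_nonneg_left (hexp _ ?_) (by norm_num)
    push_cast; linarith
  -- `A₃ = x^d κ² / x⁴ = 4 x^{-2} ≤ 4y`
  have hA₃ : x ^ d * κ ^ 2 / x ^ 4 ≤ 4 * y := by
    have heq : x ^ d * κ ^ 2 / x ^ 4 = 4 * x ^ ((d : ℝ) + 2 * (-(((d : ℝ) - 2) / 2)) - (4 : ℕ)) := by
      rw [hκ, hxpow d, hxpow 4, Real.rpow_sub hx, Real.rpow_add hx, mul_pow, ← Real.rpow_natCast (x ^ _) 2,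
        ← Real.rpow_mul hx.le]
      push_cast; ring
    rw [heq]
    refine mul_le_mul_of_nonneg_left (hexp _ ?_) (by norm_num)
    push_cast; linarith
  -- `A₄ = x^d κ³ / x³ = 8 x^{-d/2} ≤ 8y`
  have hA₄ : x ^ d * κ ^ 3 / x ^ 3 ≤ 8 * y := by
    have heq : x ^ d * κ ^ 3 / x ^ 3 = 8 * x ^ ((d : ℝ) + 3 * (-(((d : ℝ) - 2) / 2)) - (3 : ℕ)) := by
      rw [hκ, hxpow d, hxpow 3, Real.rpow_sub hx, Real.rpow_add hx, mul_pow, ← Real.rpow_natCast (x ^ _) 3,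
        ← Real.rpow_mul hx.le]
      push_cast; ring
    rw [heq]
    refine mul_le_mul_of_nonneg_left (hexp _ ?_) (by norm_num)
    push_cast; linarith
  -- unfold the constant and regroup `x^d · (…)` into the four monomials
  have hratio : κ / 1 * (1 / x) = κ / x := by rw [div_one, one_div, div_eq_mul_inv]
  have hmain : x ^ d * abkmContrConst d L R =
      1536 * P * (E ^ n₁ * (x ^ d * κ / x ^ n₁) + (2 * E ^ 2 * (x ^ d * κ ^ 2 / x ^ 3) +
        E ^ 4 * (x ^ d * κ ^ 2 / x ^ 4)) + 3 * (x ^ d * κ ^ 3 / x ^ 3)) := by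
    unfold abkmContrConst blockContrConst pi2ContrFactor
    rw [← hκdef, ← hxdef, ← hP, hratio]
    have hx0 : x ≠ 0 := hx.ne'
    field_simp
    ring
  rw [hmain]
  have hEn : 0 ≤ E ^ n₁ := by positivity
  have hE2 : 0 ≤ E ^ 2 := by positivity
  have hE4 : 0 ≤ E ^ 4 := by positivity
  calc 1536 * P * (E ^ n₁ * (x ^ d * κ / x ^ n₁) + (2 * E ^ 2 * (x ^ d * κ ^ 2 / x ^ 3) +
        E ^ 4 * (x ^ d * κ ^ 2 / x ^ 4)) + 3 * (x ^ d * κ ^ 3 / x ^ 3))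
      ≤ 1536 * P * (E ^ n₁ * (2 * y) + (2 * E ^ 2 * (4 * y) + E ^ 4 * (4 * y)) + 3 * (8 * y)) := by
        gcongr
    _ = abkmDecayConst d R * y := by rw [abkmDecayConst, ← hE, ← hP, ← hn₁]; ring

/-- **`L^d · abkmContrConst d L R → 0` as `L → ∞`** (`d ≥ 3`): the contraction constant of the linearised
map is eventually small, [ABKM19] Theorem 6.7's `θ < 1` for `L ≥ L₀`.
[cite: AdamsBuchholzKoteckyMuller2019, Theorem 6.7] -/
theorem tendsto_pow_mul_abkmContrConst (hd : 3 ≤ d) (R : ℕ) :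
    Tendsto (fun L : ℕ => (L : ℝ) ^ d * abkmContrConst d L R) atTop (𝓝 0) := by
  have hup : Tendsto (fun L : ℕ => abkmDecayConst d R * (L : ℝ) ^ (-(1 / 2 : ℝ))) atTop (𝓝 0) := by
    have h1 : Tendsto (fun L : ℕ => (L : ℝ) ^ (-(1 / 2 : ℝ))) atTop (𝓝 0) :=
      (tendsto_rpow_neg_atTop (by norm_num : (0 : ℝ) < 1 / 2)).comp tendsto_natCast_atTop_atTop
    simpa using h1.const_mul (abkmDecayConst d R)
  refine squeeze_zero' ?_ ?_ hup
  · filter_upwards [eventually_ge_atTop 1] with L hL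
    have hL0 : 0 < L := hL
    have hκ0 : 0 ≤ scaleRatio d L := (scaleRatio_pos (d := d) hL0).le
    exact mul_nonneg (by positivity) (by
      unfold abkmContrConst
      exact mul_nonneg (by norm_num) (blockContrConst_nonneg d one_pos hκ0 zero_le_one
        (by exact_mod_cast hL0) (by exact_mod_cast hL0) hκ0 (by positivity) (by positivity)))
  · filter_upwards [eventually_ge_atTop 1] with L hL
    exact pow_mul_abkmContrConst_le hd hL R

end Literature.MathematicalPhysics.StatisticalMechanics.GradientRG

end
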